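import Summits.Parity.BatemanHorn.Theorems.IsogenyRedeiTypeIMainTermLocalCounts
import HarnessLib

/-!
# Route RoughValueTransport, crux RoughValueLaw (stmt-Parity-11390), line friable-deep-tail
## Stub `stub_singularSeriesFactorisation` (S2b₂β), part 2: the joint coefficient `A_f`

`--supports` file of the checked skeleton of the line `friable-deep-tail`.  For a family
`f : Fin k → ℤ[X]` we study the real arithmetic function (LOCAL NOTATION over Mathlib's
`toArithmeticFunction`, no new definitions; the consumer file repeats the notation)
`jA[k, f] = (n ↦ Σ_{d : dᵢ ∣ n, ∏ dᵢ = n} (∏ μ(dᵢ)) · #{r < n : ∀ i, dᵢ ∣ fᵢ(r)})`, the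
joint-root-count coefficient of the skeleton:

* it is multiplicative for EVERY family `f` (`isMultiplicative_jointCoeff`, the registered helper
  sub-goal `stub_singularSeriesFactorisation_joint`; Chinese remainder theorem on the tuples
  `d = d' d''`, `d' = gcd(d, m)`, `d'' = gcd(d, n)`, and on the counts via the tree's
  `TypeIMainTerm.card_filter_range_mul_of_periodic` / `sysPred_mul_iff` / `sysPred_iff_of_modEq`);
* `jA(p) = -Σᵢ ρ_{fᵢ}(p)` (`jointCoeff_prime`), `jA(p^i) = 0` for `i > k`
  (`jointCoeff_prime_pow_eq_zero_of_lt`), and `jA(p^i) = 0` for `i ≥ 2` at every prime modulo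
  which no two members have a common root (`jointCoeff_prime_pow_eq_zero_of_forall`);
* for irreducible pairwise non-associated `fᵢ` all but finitely many primes are such
  (`exists_forall_not_common_root`; resultants, tree `exists_mul_add_mul_eq_C_of_not_associated`).

No hypothesis on `f` except in the last lemma; Mathlib + tree only; no named facts.
-/

noncomputable section

open Filter Finset Polynomial
open scoped BigOperators

namespace Summit.Parity.BatemanHorn.Cruxes.RoughValueLaw.FriableDeepTail

namespace SingularSeriesFactorisation

open Literature.NumberTheory.Sieve
open Summit.Parity.BatemanHorn.Theorems

-- `quotPrecheck` cannot inspect the binder `∀ i, …` inside the notation body; the body is closed.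
set_option quotPrecheck false in
/-- The joint-root-count coefficient `A_f` of the skeleton (written exactly as there, with the
dot-notations expanded). -/
local notation "jA[" k ", " f "]" => toArithmeticFunction (fun n : ℕ =>
  ∑ d ∈ (Fintype.piFinset fun _ : Fin k => Nat.divisors n) with (∏ i, d i) = n,
    (∏ i, (ArithmeticFunction.moebius (d i) : ℝ)) *
      ((#(Finset.filter (fun r : ℕ => ∀ i, ((d i : ℕ) : ℤ) ∣ Polynomial.eval (r : ℤ) (f i))
          (Finset.range n)) : ℕ) : ℝ))

/-- The divisor tuples of `n` with product `n`. -/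
local notation "T[" k ", " n "]" => Finset.filter (fun d => (∏ i, d i) = n)
  (Fintype.piFinset fun _ : Fin k => Nat.divisors n)

section Joint

variable {k : ℕ} (f : Fin k → ℤ[X])

/-- Membership in the tuple set `T[k, n]`. [folklore] -/
theorem mem_tuples_iff {n : ℕ} {d : Fin k → ℕ} :
    d ∈ T[k, n] ↔ (∀ i, d i ∣ n) ∧ n ≠ 0 ∧ (∏ i, d i) = n := by
  rw [mem_filter, Fintype.mem_piFinset]
  constructor
  · rintro ⟨h, hprod⟩
    have hn : n ≠ 0 := by
      rintro rfl
      obtain ⟨i, -, hi⟩ := prod_eq_zero_iff.mp hprod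
      simpa [hi] using h i
    exact ⟨fun i => (Nat.mem_divisors.mp (h i)).1, hn, hprod⟩
  · rintro ⟨h, hn, hprod⟩
    exact ⟨fun i => Nat.mem_divisors.mpr ⟨h i, hn⟩, hprod⟩

/-- Unfolding lemma: `jA[k, f] n` is the skeleton's sum, for every `n` (at `n = 0` the tuple set
is empty). [folklore] -/
theorem jointCoeff_apply (n : ℕ) :
    (jA[k, f]) n = ∑ d ∈ (Fintype.piFinset fun _ : Fin k => n.divisors) with (∏ i, d i) = n,
      (∏ i, (ArithmeticFunction.moebius (d i) : ℝ)) *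
        ((#((range n).filter
            (fun r : ℕ => ∀ i, ((d i : ℕ) : ℤ) ∣ (f i).eval (r : ℤ))) : ℕ) : ℝ) := by
  rcases eq_or_ne n 0 with rfl | hn
  · rw [ArithmeticFunction.map_zero]
    refine (sum_eq_zero fun d hd => ?_).symm
    exact absurd rfl (mem_tuples_iff.mp hd).2.1
  · simp only [toArithmeticFunction, ArithmeticFunction.coe_mk, if_neg hn]

/-- Tuples of entries in `{1, p}`: `∏ d_l = p^{#{l : d_l = p}}`. [folklore] -/
theorem prod_eq_prime_pow_card {p : ℕ} {d : Fin k → ℕ} (h01 : ∀ l, d l = 1 ∨ d l = p) :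
    ∏ l, d l = p ^ #(univ.filter fun l => d l = p) := by
  rw [← prod_filter_mul_prod_filter_not univ (fun l => d l = p)]
  have h1 : ∏ l ∈ univ.filter (fun l => d l = p), d l = ∏ _l ∈ univ.filter (fun l => d l = p), p :=
    prod_congr rfl fun l hl => (mem_filter.mp hl).2
  rw [h1, prod_const, prod_eq_one, mul_one]
  intro l hl
  rcases h01 l with h | h
  · exact h
  · exact absurd h (mem_filter.mp hl).2

/-- In `T[k, p^i]`, a tuple all of whose Möbius values are non-zero has entries in `{1, p}`,
exactly `i` of them equal to `p`. [folklore] -/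
theorem card_eq_of_moebius_ne_zero {p i : ℕ} (hp : p.Prime) {d : Fin k → ℕ}
    (hd : d ∈ T[k, p ^ i]) (hμ : ∀ l, ArithmeticFunction.moebius (d l) ≠ 0) :
    (∀ l, d l = 1 ∨ d l = p) ∧ #(univ.filter fun l => d l = p) = i := by
  rw [mem_tuples_iff] at hd
  obtain ⟨hdvd, -, hprod⟩ := hd
  have h01 : ∀ l, d l = 1 ∨ d l = p := by
    intro l
    obtain ⟨e, -, hde⟩ := (Nat.dvd_prime_pow hp).mp (hdvd l)
    rcases Nat.lt_or_ge e 2 with he2 | he2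
    · interval_cases e
      · left; simpa using hde
      · right; simpa using hde
    · exfalso
      apply hμ l
      rw [hde, ArithmeticFunction.moebius_apply_prime_pow hp (by omega), if_neg (by omega)]
  refine ⟨h01, ?_⟩
  have hS := prod_eq_prime_pow_card (k := k) h01
  rw [hprod] at hS
  exact (Nat.pow_right_injective hp.two_le hS).symm

/-- `jA[k, f](p^i) = 0` for `i > k` (only tuples of entries `1, p` carry `μ ≠ 0`). [folklore] -/
theorem jointCoeff_prime_pow_eq_zero_of_lt {p i : ℕ} (hp : p.Prime) (hi : k < i) :
    (jA[k, f]) (p ^ i) = 0 := by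
  rw [jointCoeff_apply]
  refine sum_eq_zero fun d hd => ?_
  by_cases hμ : ∀ l, ArithmeticFunction.moebius (d l) ≠ 0
  · exfalso
    obtain ⟨-, hcard⟩ := card_eq_of_moebius_ne_zero hp hd hμ
    have := card_filter_le univ (fun l => d l = p)
    rw [hcard, card_univ, Fintype.card_fin] at this
    omega
  · push Not at hμ
    obtain ⟨l, hl⟩ := hμ
    rw [prod_eq_zero (mem_univ l) (by rw [hl, Int.cast_zero]), zero_mul]

/-- `jA[k, f](p^i) = 0` for `i ≥ 2` if no two members of `f` have a common root modulo `p`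
(a tuple with `μ ≠ 0` and product `p^i` has two entries `p`, and the joint count vanishes).
[folklore] -/
theorem jointCoeff_prime_pow_eq_zero_of_forall {p i : ℕ} (hp : p.Prime) (hi : 2 ≤ i)
    (hgood : ∀ a b : Fin k, a ≠ b → ∀ r : ℕ,
      ¬ ((p : ℤ) ∣ (f a).eval (r : ℤ) ∧ (p : ℤ) ∣ (f b).eval (r : ℤ))) :
    (jA[k, f]) (p ^ i) = 0 := by
  rw [jointCoeff_apply]
  refine sum_eq_zero fun d hd => ?_
  by_cases hμ : ∀ l, ArithmeticFunction.moebius (d l) ≠ 0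
  · obtain ⟨-, hcard⟩ := card_eq_of_moebius_ne_zero hp hd hμ
    have h2 : 1 < #(univ.filter fun l => d l = p) := by omega
    obtain ⟨a, ha, b, hb, hab⟩ := one_lt_card.mp h2
    rw [mem_filter] at ha hb
    have hempty : (range (p ^ i)).filter
        (fun r : ℕ => ∀ i, ((d i : ℕ) : ℤ) ∣ (f i).eval (r : ℤ)) = ∅ := by
      rw [filter_eq_empty_iff]
      intro r _ hr
      refine hgood a b hab r ⟨?_, ?_⟩
      · have := hr a
        rwa [ha.2] at this
      · have := hr b
        rwa [hb.2] at this
    rw [hempty, card_empty, Nat.cast_zero, mul_zero]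
  · push Not at hμ
    obtain ⟨l, hl⟩ := hμ
    rw [prod_eq_zero (mem_univ l) (by rw [hl, Int.cast_zero]), zero_mul]

/-- `jA[k, f](p) = -Σᵢ ρ_{fᵢ}(p)`: the tuples with product `p` are the `k` tuples with one entry
`p`, each with `μ = -1` and joint count `ρ_{fᵢ}(p)`. [folklore] -/
theorem jointCoeff_prime {p : ℕ} (hp : p.Prime) :
    (jA[k, f]) p = -∑ i, (polyRootCountMod ![f i] p : ℝ) := by
  classical
  rw [jointCoeff_apply]
  have hT : T[k, p] = (univ : Finset (Fin k)).image (fun l => Pi.mulSingle l p) := by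
    ext d
    rw [mem_tuples_iff, mem_image]
    constructor
    · rintro ⟨hdvd, -, hprod⟩
      have h01 : ∀ l, d l = 1 ∨ d l = p := fun l => (Nat.dvd_prime hp).mp (hdvd l)
      have hS := prod_eq_prime_pow_card (k := k) h01
      rw [hprod] at hS
      have hcard : #(univ.filter fun l => d l = p) = 1 :=
        (Nat.pow_right_injective hp.two_le (show p ^ #(univ.filter fun l => d l = p) = p ^ 1 by
          rw [pow_one]; exact hS.symm))
      obtain ⟨l, hl⟩ := card_eq_one.mp hcard
      have hmem : ∀ i, d i = p ↔ i = l := fun i => by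
        have : i ∈ univ.filter (fun l => d l = p) ↔ i ∈ ({l} : Finset (Fin k)) := by rw [hl]
        simpa using this
      refine ⟨l, mem_univ _, ?_⟩
      funext i
      by_cases hil : i = l
      · rw [hil, Pi.mulSingle_eq_same]
        exact ((hmem l).mpr rfl).symm
      · rw [Pi.mulSingle_eq_of_ne hil]
        rcases h01 i with h | h
        · exact h.symm
        · exact absurd ((hmem i).mp h) hil
    · rintro ⟨l, -, rfl⟩
      refine ⟨fun i => ?_, hp.ne_zero, ?_⟩
      · by_cases hil : i = l
        · rw [hil, Pi.mulSingle_eq_same]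
        · rw [Pi.mulSingle_eq_of_ne hil]
          exact one_dvd _
      · rw [Finset.prod_pi_mulSingle', if_pos (mem_univ _)]
  rw [hT, sum_image, ← sum_neg_distrib]
  · refine sum_congr rfl fun l _ => ?_
    have hμ : (∏ i, (ArithmeticFunction.moebius ((Pi.mulSingle l p : Fin k → ℕ) i) : ℝ)) = -1 := by
      rw [Fintype.prod_eq_single l (fun i hi => by
        rw [Pi.mulSingle_eq_of_ne hi, ArithmeticFunction.moebius_apply_one, Int.cast_one]),
        Pi.mulSingle_eq_same, ArithmeticFunction.moebius_apply_prime hp]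
      norm_num
    have hc : #((range p).filter
        (fun r : ℕ => ∀ i, (((Pi.mulSingle l p : Fin k → ℕ) i : ℕ) : ℤ) ∣ (f i).eval (r : ℤ))) =
        polyRootCountMod ![f l] p := by
      rw [polyRootCountMod_single]
      congr 1
      refine filter_congr fun r _ => ⟨fun h => ?_, fun h i => ?_⟩
      · have := h l
        rwa [Pi.mulSingle_eq_same] at this
      · by_cases hil : i = l
        · rw [hil, Pi.mulSingle_eq_same]
          exact h
        · rw [Pi.mulSingle_eq_of_ne hil, Nat.cast_one]
          exact one_dvd _
    rw [hμ, hc]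
    ring
  · intro l _ l' _ h
    by_contra hne
    have := congrFun h l
    dsimp only at this
    rw [Pi.mulSingle_eq_same, Pi.mulSingle_eq_of_ne hne] at this
    exact hp.ne_one this

/-- Splitting a divisor tuple of `mn`, `(m, n) = 1`, into its `m`- and `n`-parts: the products.
[folklore] -/
theorem prod_gcd_eq {m n : ℕ} (hm : m ≠ 0) (hn : n ≠ 0) (hmn : m.Coprime n) {d : Fin k → ℕ}
    (hd : ∀ i, d i ∣ m * n) (hprod : ∏ i, d i = m * n) :
    (∏ i, Nat.gcd (d i) m) = m ∧ (∏ i, Nat.gcd (d i) n) = n := by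
  set a := ∏ i, Nat.gcd (d i) m with ha0
  set b := ∏ i, Nat.gcd (d i) n with hb0
  have hab : a * b = m * n := by
    rw [← hprod, ha0, hb0, ← prod_mul_distrib]
    exact prod_congr rfl fun i _ => by rw [← Nat.Coprime.gcd_mul (d i) hmn, Nat.gcd_eq_left (hd i)]
  have ha : a.Coprime n := Nat.Coprime.prod_left fun i _ =>
    Nat.Coprime.coprime_dvd_left (Nat.gcd_dvd_right _ _) hmn
  have hb : b.Coprime m := Nat.Coprime.prod_left fun i _ =>
    Nat.Coprime.coprime_dvd_left (Nat.gcd_dvd_right _ _) hmn.symm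
  have ha' : a ∣ m := ha.dvd_of_dvd_mul_right (hab ▸ dvd_mul_right a b)
  have hb' : b ∣ n := hb.dvd_of_dvd_mul_left (hab ▸ dvd_mul_left b a)
  obtain ⟨u, hu⟩ := ha'
  obtain ⟨v, hv⟩ := hb'
  have h0 : 0 < a * b := by
    rw [hab]
    exact Nat.pos_of_ne_zero (Nat.mul_ne_zero hm hn)
  have huv : u * v = 1 := by
    refine Nat.eq_of_mul_eq_mul_left h0 ?_
    calc a * b * (u * v) = (a * u) * (b * v) := by ring
      _ = m * n := by rw [← hu, ← hv]
      _ = a * b * 1 := by rw [mul_one, hab]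
  have hu1 : u = 1 := Nat.eq_one_of_mul_eq_one_right huv
  have hv1 : v = 1 := Nat.eq_one_of_mul_eq_one_left huv
  exact ⟨by rw [hu, hu1, mul_one], by rw [hv, hv1, mul_one]⟩

/-- Möbius of a componentwise product of tuples dividing coprime `m`, `n`. [folklore] -/
theorem prod_moebius_mul {m n : ℕ} (hmn : m.Coprime n) {d' d'' : Fin k → ℕ}
    (h1 : ∀ i, d' i ∣ m) (h2 : ∀ i, d'' i ∣ n) :
    (∏ i, (ArithmeticFunction.moebius ((d' * d'') i) : ℝ)) =
      (∏ i, (ArithmeticFunction.moebius (d' i) : ℝ)) *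
        ∏ i, (ArithmeticFunction.moebius (d'' i) : ℝ) := by
  rw [← prod_mul_distrib]
  refine prod_congr rfl fun i _ => ?_
  rw [Pi.mul_apply, ArithmeticFunction.isMultiplicative_moebius.map_mul_of_coprime
    (Nat.Coprime.of_dvd (h1 i) (h2 i) hmn), Int.cast_mul]

/-- **CRT for the joint counts**: for tuples `d' ∣ m`, `d'' ∣ n` with `∏ d' = m`, `∏ d'' = n`,
`(m, n) = 1`, the count modulo `mn` of `d'ᵢ d''ᵢ ∣ fᵢ(r)` is the product of the counts
(tree: `TypeIMainTerm.card_filter_range_mul_of_periodic`, `sysPred_mul_iff`,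
`sysPred_iff_of_modEq`). [folklore] -/
theorem card_filter_mul {m n : ℕ} (hmn : m.Coprime n) {d' d'' : Fin k → ℕ}
    (h1 : ∀ i, d' i ∣ m) (h2 : ∀ i, d'' i ∣ n) (hp1 : ∏ i, d' i = m) (hp2 : ∏ i, d'' i = n) :
    #((range (m * n)).filter (fun r : ℕ => ∀ i, (((d' * d'') i : ℕ) : ℤ) ∣ (f i).eval (r : ℤ))) =
      #((range m).filter (fun r : ℕ => ∀ i, ((d' i : ℕ) : ℤ) ∣ (f i).eval (r : ℤ))) *
        #((range n).filter (fun r : ℕ => ∀ i, ((d'' i : ℕ) : ℤ) ∣ (f i).eval (r : ℤ))) := by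
  have hcop : Nat.Coprime (∏ i, d' i) (∏ i, d'' i) := by rwa [hp1, hp2]
  rw [← TypeIMainTerm.card_filter_range_mul_of_periodic hmn _ _
    (fun r => TypeIMainTerm.sysPred_iff_of_modEq f d' h1 (Nat.mod_modEq r m).symm)
    (fun r => TypeIMainTerm.sysPred_iff_of_modEq f d'' h2 (Nat.mod_modEq r n).symm)]
  congr 1
  exact filter_congr fun r _ => TypeIMainTerm.sysPred_mul_iff f hcop r

/-- **`A_f` is multiplicative** for every family `f` (no hypothesis): `A_f(1) = 1`, and for
coprime `m, n` the tuples of `mn` are the componentwise products of the tuples of `m` and of `n`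
(`d ↦ (gcd(d, m), gcd(d, n))`), with `μ` and the joint counts multiplicative along this
bijection. [folklore] -/
theorem isMultiplicative_jointCoeff : (jA[k, f]).IsMultiplicative := by
  refine ArithmeticFunction.IsMultiplicative.iff_ne_zero.mpr ⟨?_, ?_⟩
  · rw [jointCoeff_apply]
    have hT : T[k, 1] = {fun _ => 1} := by
      ext d
      rw [mem_tuples_iff, mem_singleton]
      constructor
      · rintro ⟨h, -, -⟩
        funext i
        exact Nat.dvd_one.mp (h i)
      · rintro rfl
        exact ⟨fun _ => dvd_rfl, one_ne_zero, by simp⟩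
    rw [hT, sum_singleton]
    simp
  · intro m n hm hn hmn
    rw [jointCoeff_apply, jointCoeff_apply, jointCoeff_apply, sum_mul_sum, ← sum_product']
    symm
    refine sum_nbij' (fun x => x.1 * x.2)
      (fun d => (fun i => Nat.gcd (d i) m, fun i => Nat.gcd (d i) n)) ?_ ?_ ?_ ?_ ?_
    · rintro ⟨d', d''⟩ hx
      obtain ⟨hd', hd''⟩ := mem_product.mp hx
      dsimp only at hd' hd'' ⊢
      rw [mem_tuples_iff] at hd' hd'' ⊢
      refine ⟨fun i => mul_dvd_mul (hd'.1 i) (hd''.1 i), Nat.mul_ne_zero hm hn, ?_⟩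
      rw [← hd'.2.2, ← hd''.2.2, ← prod_mul_distrib]
      rfl
    · intro d hd
      rw [mem_tuples_iff] at hd
      obtain ⟨hdvd, -, hprod⟩ := hd
      obtain ⟨ha, hb⟩ := prod_gcd_eq hm hn hmn hdvd hprod
      rw [mem_product, mem_tuples_iff, mem_tuples_iff]
      exact ⟨⟨fun i => Nat.gcd_dvd_right _ _, hm, ha⟩, ⟨fun i => Nat.gcd_dvd_right _ _, hn, hb⟩⟩
    · rintro ⟨d', d''⟩ hx
      obtain ⟨hd', hd''⟩ := mem_product.mp hx
      dsimp only at hd' hd'' ⊢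
      rw [mem_tuples_iff] at hd' hd''
      refine Prod.ext ?_ ?_
      · funext i
        show Nat.gcd (d' i * d'' i) m = d' i
        rw [Nat.Coprime.gcd_mul_right_cancel (d' i) (hmn.symm.coprime_dvd_left (hd''.1 i))]
        exact Nat.gcd_eq_left (hd'.1 i)
      · funext i
        show Nat.gcd (d' i * d'' i) n = d'' i
        rw [Nat.Coprime.gcd_mul_left_cancel (d'' i) (hmn.coprime_dvd_left (hd'.1 i))]
        exact Nat.gcd_eq_left (hd''.1 i)
    · intro d hd
      rw [mem_tuples_iff] at hd
      funext i
      show Nat.gcd (d i) m * Nat.gcd (d i) n = d i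
      rw [← Nat.Coprime.gcd_mul (d i) hmn, Nat.gcd_eq_left (hd.1 i)]
    · rintro ⟨d', d''⟩ hx
      obtain ⟨hd', hd''⟩ := mem_product.mp hx
      dsimp only at hd' hd'' ⊢
      rw [mem_tuples_iff] at hd' hd''
      rw [prod_moebius_mul hmn hd'.1 hd''.1,
        card_filter_mul f hmn hd'.1 hd''.1 hd'.2.2 hd''.2.2]
      push_cast
      ring

/-- For irreducible, pairwise non-associated `fᵢ` there is `P₀` such that no prime `p > P₀`
divides two values `f_a(r)`, `f_b(r)` (`a ≠ b`) at the same integer `r`: `f_a u + f_b v = c ≠ 0`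
(tree `exists_mul_add_mul_eq_C_of_not_associated`) and `p ∤ c` for `p > Σ |c_{ab}|`.
[folklore] -/
theorem exists_forall_not_common_root (hirr : ∀ i, Irreducible (f i))
    (hna : Pairwise fun i j => ¬Associated (f i) (f j)) :
    ∃ P₀ : ℕ, ∀ p : ℕ, p.Prime → P₀ < p → ∀ a b : Fin k, a ≠ b →
      ∀ r : ℕ, ¬ ((p : ℤ) ∣ (f a).eval (r : ℤ) ∧ (p : ℤ) ∣ (f b).eval (r : ℤ)) := by
  classical
  have key : ∀ a b : Fin k, a ≠ b → ∃ (u v : ℤ[X]) (c : ℤ), c ≠ 0 ∧ f a * u + f b * v = C c :=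
    fun a b hab => exists_mul_add_mul_eq_C_of_not_associated (hirr a) (hirr b) (hna hab)
  choose! u v c hc0 hc using key
  refine ⟨∑ a, ∑ b, (c a b).natAbs, fun p hp hP a b hab r hr => ?_⟩
  obtain ⟨ha, hb⟩ := hr
  have hpc : ¬ (p : ℤ) ∣ c a b := by
    intro hdvd
    have h1 : p ∣ (c a b).natAbs := Int.natCast_dvd.mp hdvd
    have h2 : (c a b).natAbs ≤ ∑ a, ∑ b, (c a b).natAbs :=
      (single_le_sum (f := fun b => (c a b).natAbs) (by simp) (mem_univ b)).trans
        (single_le_sum (f := fun a => ∑ b, (c a b).natAbs) (by simp) (mem_univ a))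
    have h3 := Nat.le_of_dvd (Int.natAbs_pos.mpr (hc0 a b hab)) h1
    omega
  apply hpc
  have e := congrArg (eval (r : ℤ)) (hc a b hab)
  rw [eval_add, eval_mul, eval_mul, eval_C] at e
  rw [← e]
  exact dvd_add (dvd_mul_of_dvd_left ha _) (dvd_mul_of_dvd_left hb _)

end Joint

end SingularSeriesFactorisation

/-- **Registered helper sub-goal (part 2 of `stub_singularSeriesFactorisation`)**: the joint
coefficient `A_f` of the skeleton is a multiplicative arithmetic function, for every family `f`.
[folklore] -/
theorem stub_singularSeriesFactorisation_joint :
    ∀ (k : ℕ) (f : Fin k → ℤ[X]), ArithmeticFunction.IsMultiplicative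
      (toArithmeticFunction (fun n : ℕ =>
        ∑ d ∈ (Fintype.piFinset fun _ : Fin k => n.divisors) with (∏ i, d i) = n,
          (∏ i, (ArithmeticFunction.moebius (d i) : ℝ)) *
            ((#((range n).filter
                (fun r : ℕ => ∀ i, ((d i : ℕ) : ℤ) ∣ (f i).eval (r : ℤ))) : ℕ) : ℝ))) :=
  fun _ f => SingularSeriesFactorisation.isMultiplicative_jointCoeff f

end Summit.Parity.BatemanHorn.Cruxes.RoughValueLaw.FriableDeepTail

end
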